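import Summits.BirchSwinnertonDyer.Rank1Residual.AdditivePotMult.RankZeroChiBranchThreeFacts
import Summits.BirchSwinnertonDyer.Rank1Residual.AdditivePotMult.RankZeroChiBranchPrimeFacts
import Literature.NumberTheory.EllipticCurves.Rank1Residual.Typed.CasselsLowerBound
import HarnessLib

/-!
# X3♯(M) and X4(M) ∧ surj(p), analytic rank `0`, `p ∣ #Ш_an(E)`: `BSD(E,p)` from the published UPPER
# half + Cassels–Tate squareness + the finite certificate `p ∣ #Ш(E/ℚ)` (cell `b2b-bsdres`, seat additive-p1, gen 11)

HONEST FRAMING (cell `b2b-bsdres`, run/shared/lean/b2b/bsd-rank1-residual/, verbatim in every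
file): the goal of the cell is to DELETE the COMBINATION-SHAPED residual classes of the
Birch–Swinnerton-Dyer formula for ALL analytic-rank `≤ 1` elliptic curves over `ℚ` — "full BSD
formula for every rank `≤ 1` curve in class `C`" assembled STRICTLY from published theorems — so
that the rank-`≤ 1` remainder becomes exactly the CONSTRUCTION-SHAPED classes, which are TYPED
(missing-input `Prop`s), NOT attempted. This is not "finishing BSD". The additive sub-cell (seats
additive-p1…p4) is a RESEARCH ROUTE on the construction-shaped classes X3/X4; sub-cell additive-p1
= the potentially MULTIPLICATIVE additive prime (X3♯(M) / X4(M)); no claim beyond the stated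
classes; the labels of X3/X4 are UNCHANGED by this file; nothing is booked (referee).

Theorems only (pure compositions; no definition, no named fact minted).

**What this file records.** On X3♯(M) (`E[p]` reducible) and on X4(M) ∧ surj(p), in analytic rank
`0`, at EVERY odd `p`, the UPPER half `ord_p #Ш(E) ≤ ord_p #Ш_an(E)` is a kernel theorem for every
curve of the class from published theorems (gen 9: `ClassX3M.missingUpperBoundAt_rankZero`,
`ClassX4M.missingUpperBoundAt_rankZero_of_surj`, p237427; at `p = 3` the A122/A123 twins of
`RankZeroChiBranchThreeFacts.lean`, p234351), so what is missing at such a pair is EXACTLY the LOWER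
half `MissingLowerBoundAt W p` (`…missingInputAt_iff_lower…`), and `BSD(E,p)` holds outright on the
`p ∤ #Ш_an(E)` rows (`…_of_shaAn_unit`). On the remaining rank-`0` rows, `p ∣ #Ш_an(E)`, that lower
half is NOT a missing theorem but a FINITE CERTIFICATE, exactly as on the non-additive classes
(`Typed/CasselsLowerBound.lean`: X11 / X6 / X7 / X8 / X2, where the upper half is Wuthrich 2014
Prop. 21 — which EXCLUDES additive `p`): if `ord_p #Ш_an(E) ≤ 2k` and `p^{2k−1} ∣ #Ш(E/ℚ)` then, `#Ш`
being a perfect square by the Cassels–Tate pairing (`hCT` = bsd.S18; Cassels 1962, Silverman AEC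
X.4.14), `2k ≤ ord_p #Ш(E)`, which is the lower half (`missingLowerBoundAt_of_casselsTate_of_pow_dvd`).
For `k = 1` — the only case in the window — the certificate is ONE nonzero element of `Ш(E/ℚ)`
killed by `p`, i.e. `Ш(E/ℚ)[p] ≠ 0` (`dvd_shaOrder_of_exists_torsion`), the output of a `p`-descent.
THIS FILE composes the two: on the sub-cell's classes the upper half that Wuthrich's Prop. 21 does
not give at an additive prime is supplied by the gen-9 theorems, so the SAME certificate closes the
pair.

**Where it bites (census `hyp_bits.tsv` × sha-2 `verdicts_oddp.tsv`, N < 2·10⁴ ‖ 10⁴, read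
2026-08-20T23:55Z; numbers, lane/referee to rule).** Rank-`0` (M) rows with `p ∣ #Ш_an(E)`:
61 = **54 ‖ 21 X4(M) ∧ surj(3) at `p = 3`** (`#Ш_an = 9`; ALL carry sha-2's verdict "RESISTANT — (d)
`Ш(E)[3] = (ℤ/3)²` certified (dim Sel³ = 2, r = 0; two implementations since sha-2 GEN 10: engine A +
`sel3chk`); exact order not pinned by a first descent: 3 additive (Wuthrich Prop. 21 excludes
additive p)" — i.e. the LOWER bound is certified twice and only the UPPER bound was lacking in the
lane's rule table; `ClassX4M.bsdp_three_rankZero_of_surj_of_casselsTate_of_dvd` below supplies it: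
2601h1, 2718d1, 3879e1, 3933a1, 5499e1, 5760m1, 5922c1, 6165g1, 6336cn1, 6336n1, 6408a1, 6570b1,
6705g1, 6867e1, 7110e1, 7488o1, 7704q1, 8379o1, 9162e1, 9225s1, 9378d1 ‖ 10062c1, 10350i1, 10440d1,
10458h1, 11322d1, 11385k1, 11808g1, 12888c1, 12915e1, 13221g1, 13680be1, 14238b1, 14400bv1, 14400fe1,
15102c1, 15129e1, 15264d1, 15426e1, 16317m1, 16434a1, 16920e1, 17136bd1, 17190k1, 17208b1, 17208i1,
17568k1, 17640ce1, 17856u1, 18774o1, 19107f1, 19134b1, 19350m1, 19674k1; surj(3) on all 54 by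
Cremona's galrep, and in the kernel by `3 ∤ ord₃ j` where it holds, e.g. 13221g1, `ord₃ j = −19`)
+ **3 X3♯(M) at `p = 3`** (`#Ш_an = 9`: 8190bz1, 13860x1 — sha-2 "CLOSED:Sha[p]!=0,square" through an
isogenous curve — and 15138i1, sha-2 "RESISTANT, one engine: `Ш[3] ≠ 0` in the class") + **4 X4(M)
∧ surj(5) at `p = 5`** (`#Ш_an = 25`: 12300e1, 15300s1, 16800i1, 19600by1 — sha-2
"CLOSED:Sha[p]!=0,square", visible `Ш[5]`). For each: `BSD(E,p)` ⇐ [Delbourgo 1998 Prop. 4 + GZK +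
modularity + Wuthrich 2014 Thm. 16 / Lemma 20 + Kato 17.4 componentwise readings + Cassels–Tate, all
PUBLISHED] + [the finite certificate `Ш(E)[p] ≠ 0`]. NOT a class theorem: the certificate is per
curve; rows with `ord_p #Ш_an ≥ 4` would need `p³ ∣ #Ш`. Nothing booked here.

**This file proves** (binders: `hCT` = bsd.S18 Cassels–Tate pairing; `hDel` = Delbourgo 1998
Prop. 4; `hGZK` = bsd.S17; `hmod`, `hmodD` = modularity; `hW16` / `hKato` / `hL20` = the Wuthrich
2014 / Kato 2004 readings of record — all published):
* §1 every odd `p`: `ClassX3M.missingLowerBoundAt_of_casselsTate_of_pow_dvd` is just the generic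
  adapter; `ClassX3M.bsdp_rankZero_of_casselsTate_of_pow_dvd` / `…_of_dvd`,
  `ClassX3M.missingInputAt_of_casselsTate_of_dvd_rankZero` (the typed input X3♯ DISCHARGED by the
  certificate); `ClassX4M.bsdp_rankZero_of_surj_of_casselsTate_of_pow_dvd` / `…_of_dvd`,
  `…_of_not_dvd_padicValRat_j_of_casselsTate_of_dvd`, `ClassX4M.missingInputAt_of_surj_of_casselsTate_of_dvd_rankZero`;
* §2 `p = 3` (inputs A122/A123, the theorems of record for the 57 window rows at `3`):
  `ClassX3M.bsdp_three_rankZero_of_casselsTate_of_dvd`,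
  `ClassX4M.bsdp_three_rankZero_of_surj_of_casselsTate_of_dvd`,
  `ClassX4M.bsdp_three_rankZero_of_not_dvd_padicValRat_j_of_casselsTate_of_dvd`, and the
  element-shaped forms `…_of_exists_torsion` (certificate = a nonzero `x ∈ Ш(E/ℚ)` with `3x = 0`).

References: Cassels 1962 [Cassels1962ArithmeticIV]; Silverman AEC X.4.14 [SilvermanAEC2009];
Delbourgo 1998 [Delbourgo1998] Prop. 4; Wuthrich 2014 [Wuthrich2014] Thm. 16, Lemma 20, Cor. 19;
Kato 2004 [Kato2004Asterisque] Thm. 17.4; Miller 2011 §1, Def. 1.1 [Miller2011LMS]; Schaefer–Stoll,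
Trans. AMS 356 (2004) 1209–1231 (the `p`-descent behind the certificates; lane's engines).
-/

noncomputable section

open scoped Classical

open WeierstrassCurve Literature.NumberTheory.EllipticCurves
  Literature.NumberTheory.EllipticCurves.ModularForms
  Literature.NumberTheory.EllipticCurves.Rank1Residual
  Literature.NumberTheory.EllipticCurves.Rank1Residual.Typed

namespace Summit.BirchSwinnertonDyer.Rank1Residual.AdditivePotMult

open Additive GaloisImage

variable {W : WeierstrassCurve ℚ} [W.IsElliptic] [W.IsGloballyMinimal] {p : ℕ} [hp : Fact p.Prime]

/-! ### §1 Every odd `p` -/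

/-- **X3♯(M) ∧ `r_an(E) = 0`, ANY odd `p`, `ord_p #Ш_an(E) ≤ 2k`, certificate `p^{2k−1} ∣ #Ш(E/ℚ)` ⇒
`BSD(E,p)`.** Upper half: the gen-9 class theorem (Delbourgo Prop. 4 `hDel`, GZK, modularity,
Wuthrich Thm. 16 `ω^{(p−1)/2}`-component `hW16`); lower half: Cassels–Tate squareness (`hCT`) and the
certificate (`missingLowerBoundAt_of_casselsTate_of_pow_dvd`); `Ш` finite by `hGZK`. The certificate is
per curve; NOT a class theorem. [cite: SilvermanAEC2009, Thm. X.4.14] [cite: Delbourgo1998, Prop. 4 (p. 144)]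
[cite: Wuthrich2014, Thm. 16 (p. 397)] [cite: Miller2011LMS, §1 and Def. 1.1] -/
theorem ClassX3M.bsdp_rankZero_of_casselsTate_of_pow_dvd
    (hCT : exists_casselsTate_pairing (K := ℚ))
    (hDel : Delbourgo1998.prop4_rankZero_pow_dvd_constantCoeff)
    (hGZK : rank_eq_analyticRank_of_analyticRank_le_one) (hmod : hasEntireLFunction_rat)
    (hmodD : nonempty_modularParametrizationData)
    (hW16 : Wuthrich2014.thm16_halfEigenCharIdeal_dvd_cyclotomicPrime)
    (hX : ClassX3M W p) (hr : W.analyticRank = 0)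
    {q : ℚ} (hq : shaAn W = (q : ℂ)) {k : ℕ} (hv : padicValRat p q ≤ 2 * k)
    (hdvd : p ^ (2 * k - 1) ∣ W.shaOrder) : BSDp W p :=
  ClassX3M.bsdp_rankZero_of_lower hDel hGZK hmod hmodD hW16 hX hr
    (missingLowerBoundAt_of_casselsTate_of_pow_dvd W p hCT (hGZK W (by omega)).2 hq hv hdvd)

/-- **The `k = 1` case** (`ord_p #Ш_an(E) ≤ 2`, ONE certificate `p ∣ #Ш(E/ℚ)`, i.e. `Ш(E/ℚ)[p] ≠ 0`):
X3♯(M) ∧ `r_an(E) = 0`, any odd `p` ⇒ `BSD(E,p)`. [cite: SilvermanAEC2009, Thm. X.4.14]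
[cite: Delbourgo1998, Prop. 4 (p. 144)] [cite: Wuthrich2014, Thm. 16 (p. 397)] -/
theorem ClassX3M.bsdp_rankZero_of_casselsTate_of_dvd
    (hCT : exists_casselsTate_pairing (K := ℚ))
    (hDel : Delbourgo1998.prop4_rankZero_pow_dvd_constantCoeff)
    (hGZK : rank_eq_analyticRank_of_analyticRank_le_one) (hmod : hasEntireLFunction_rat)
    (hmodD : nonempty_modularParametrizationData)
    (hW16 : Wuthrich2014.thm16_halfEigenCharIdeal_dvd_cyclotomicPrime)
    (hX : ClassX3M W p) (hr : W.analyticRank = 0)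
    {q : ℚ} (hq : shaAn W = (q : ℂ)) (hv : padicValRat p q ≤ 2) (hdvd : p ∣ W.shaOrder) :
    BSDp W p :=
  ClassX3M.bsdp_rankZero_of_casselsTate_of_pow_dvd hCT hDel hGZK hmod hmodD hW16 hX hr hq (k := 1)
    (by simpa using hv) (by simpa using hdvd)

/-- **X3♯(M) ∧ `r_an(E) = 0`, any odd `p`, `ord_p #Ш_an(E) ≤ 2`, certificate `p ∣ #Ш(E/ℚ)`: the typed
missing input `X3.MissingInputAt W p` HOLDS** (the construction-shaped input is DISCHARGED at such a
pair by the finite certificate; per curve, not a class statement). [cite: SilvermanAEC2009, Thm. X.4.14]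
[cite: Delbourgo1998, Prop. 4 (p. 144)] [cite: Wuthrich2014, Thm. 16 (p. 397)] -/
theorem ClassX3M.missingInputAt_of_casselsTate_of_dvd_rankZero
    (hCT : exists_casselsTate_pairing (K := ℚ))
    (hDel : Delbourgo1998.prop4_rankZero_pow_dvd_constantCoeff)
    (hGZK : rank_eq_analyticRank_of_analyticRank_le_one) (hmod : hasEntireLFunction_rat)
    (hmodD : nonempty_modularParametrizationData)
    (hW16 : Wuthrich2014.thm16_halfEigenCharIdeal_dvd_cyclotomicPrime)
    (hX : ClassX3M W p) (hr : W.analyticRank = 0)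
    {q : ℚ} (hq : shaAn W = (q : ℂ)) (hv : padicValRat p q ≤ 2) (hdvd : p ∣ W.shaOrder) :
    X3.MissingInputAt W p :=
  (ClassX3M.missingInputAt_iff_lower_rankZero hDel hGZK hmod hmodD hW16 hX hr).mpr
    (missingLowerBoundAt_of_casselsTate_of_pow_dvd W p hCT (hGZK W (by omega)).2 hq (k := 1)
      (by simpa using hv) (by simpa using hdvd))

/-- **X4(M) ∧ `r_an(E) = 0` ∧ surj(p), ANY odd `p`, `ord_p #Ш_an(E) ≤ 2k`, certificate
`p^{2k−1} ∣ #Ш(E/ℚ)` ⇒ `BSD(E,p)`.** Upper half: the gen-9 class theorem (Delbourgo Prop. 4, GZK,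
modularity, Wuthrich Lemma 20 `hL20` — used only at `p = 3` — and Kato's divisibility read on the
`ω^{(p−1)/2}`-component `hKato`); lower half: Cassels–Tate squareness (`hCT`) + certificate. Per curve;
NOT a class theorem. [cite: SilvermanAEC2009, Thm. X.4.14] [cite: Delbourgo1998, Prop. 4 (p. 144)]
[cite: Wuthrich2014, Lemma 20 (p. 399), Cor. 19 (p. 398)] [cite: Kato2004Asterisque, Thm. 17.4 (3) (p. 273)] -/
theorem ClassX4M.bsdp_rankZero_of_surj_of_casselsTate_of_pow_dvd
    (hCT : exists_casselsTate_pairing (K := ℚ))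
    (hDel : Delbourgo1998.prop4_rankZero_pow_dvd_constantCoeff)
    (hGZK : rank_eq_analyticRank_of_analyticRank_le_one) (hmod : hasEntireLFunction_rat)
    (hmodD : nonempty_modularParametrizationData)
    (hL20 : Wuthrich2014.lemma20_surjective_threeAdic_of_semistable)
    (hKato : Wuthrich2014.kato_halfEigenCharIdeal_dvd_cyclotomicPrime_of_surjective)
    (hX : ClassX4M W p) (hr : W.analyticRank = 0) (hsurj : Surj W p)
    {q : ℚ} (hq : shaAn W = (q : ℂ)) {k : ℕ} (hv : padicValRat p q ≤ 2 * k)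
    (hdvd : p ^ (2 * k - 1) ∣ W.shaOrder) : BSDp W p :=
  ClassX4M.bsdp_rankZero_of_surj_of_lower hDel hGZK hmod hmodD hL20 hKato hX hr hsurj
    (missingLowerBoundAt_of_casselsTate_of_pow_dvd W p hCT (hGZK W (by omega)).2 hq hv hdvd)

/-- **The `k = 1` case**: X4(M) ∧ `r_an(E) = 0` ∧ surj(p), any odd `p`, `ord_p #Ш_an(E) ≤ 2`,
certificate `p ∣ #Ш(E/ℚ)` ⇒ `BSD(E,p)` (window rows at `p = 5`: 12300e1, 15300s1, 16800i1, 19600by1,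
`#Ш_an = 25`, sha-2's visible `Ш[5]`). [cite: SilvermanAEC2009, Thm. X.4.14]
[cite: Delbourgo1998, Prop. 4 (p. 144)] [cite: Wuthrich2014, Lemma 20 (p. 399), Cor. 19 (p. 398)] -/
theorem ClassX4M.bsdp_rankZero_of_surj_of_casselsTate_of_dvd
    (hCT : exists_casselsTate_pairing (K := ℚ))
    (hDel : Delbourgo1998.prop4_rankZero_pow_dvd_constantCoeff)
    (hGZK : rank_eq_analyticRank_of_analyticRank_le_one) (hmod : hasEntireLFunction_rat)
    (hmodD : nonempty_modularParametrizationData)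
    (hL20 : Wuthrich2014.lemma20_surjective_threeAdic_of_semistable)
    (hKato : Wuthrich2014.kato_halfEigenCharIdeal_dvd_cyclotomicPrime_of_surjective)
    (hX : ClassX4M W p) (hr : W.analyticRank = 0) (hsurj : Surj W p)
    {q : ℚ} (hq : shaAn W = (q : ℂ)) (hv : padicValRat p q ≤ 2) (hdvd : p ∣ W.shaOrder) :
    BSDp W p :=
  ClassX4M.bsdp_rankZero_of_surj_of_casselsTate_of_pow_dvd hCT hDel hGZK hmod hmodD hL20 hKato hX hr
    hsurj hq (k := 1) (by simpa using hv) (by simpa using hdvd)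

/-- **X4(M) ∧ `r_an(E) = 0` ∧ `p ∤ ord_p j(E)`, any odd `p`, `ord_p #Ш_an(E) ≤ 2`, certificate
`p ∣ #Ш(E/ℚ)` ⇒ `BSD(E,p)`** — surj(p) decided in the kernel by `p ∤ ord_p j(E)`
(`ClassX4M.surj_of_not_dvd_padicValRat_j`). [cite: SilvermanATAEC1994, V.6 Prop. 6.1 (p. 410) and V.5.3]
[cite: SilvermanAEC2009, Thm. X.4.14] [cite: Wuthrich2014, Lemma 20 (p. 399), Cor. 19 (p. 398)] -/
theorem ClassX4M.bsdp_rankZero_of_not_dvd_padicValRat_j_of_casselsTate_of_dvd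
    (hCT : exists_casselsTate_pairing (K := ℚ))
    (hDel : Delbourgo1998.prop4_rankZero_pow_dvd_constantCoeff)
    (hGZK : rank_eq_analyticRank_of_analyticRank_le_one) (hmod : hasEntireLFunction_rat)
    (hmodD : nonempty_modularParametrizationData)
    (hL20 : Wuthrich2014.lemma20_surjective_threeAdic_of_semistable)
    (hKato : Wuthrich2014.kato_halfEigenCharIdeal_dvd_cyclotomicPrime_of_surjective)
    (hX : ClassX4M W p) (hr : W.analyticRank = 0) (hj : ¬ (p : ℤ) ∣ padicValRat p W.j)
    {q : ℚ} (hq : shaAn W = (q : ℂ)) (hv : padicValRat p q ≤ 2) (hdvd : p ∣ W.shaOrder) :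
    BSDp W p :=
  ClassX4M.bsdp_rankZero_of_surj_of_casselsTate_of_dvd hCT hDel hGZK hmod hmodD hL20 hKato hX hr
    (ClassX4M.surj_of_not_dvd_padicValRat_j hX hj) hq hv hdvd

/-- **X4(M) ∧ `r_an(E) = 0` ∧ surj(p), any odd `p`, `ord_p #Ш_an(E) ≤ 2`, certificate `p ∣ #Ш(E/ℚ)`:
the typed missing input `X4.MissingInputAt W p` HOLDS** (discharged at the pair by the finite
certificate; per curve). [cite: SilvermanAEC2009, Thm. X.4.14] [cite: Delbourgo1998, Prop. 4 (p. 144)]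
[cite: Wuthrich2014, Lemma 20 (p. 399), Cor. 19 (p. 398)] -/
theorem ClassX4M.missingInputAt_of_surj_of_casselsTate_of_dvd_rankZero
    (hCT : exists_casselsTate_pairing (K := ℚ))
    (hDel : Delbourgo1998.prop4_rankZero_pow_dvd_constantCoeff)
    (hGZK : rank_eq_analyticRank_of_analyticRank_le_one) (hmod : hasEntireLFunction_rat)
    (hmodD : nonempty_modularParametrizationData)
    (hL20 : Wuthrich2014.lemma20_surjective_threeAdic_of_semistable)
    (hKato : Wuthrich2014.kato_halfEigenCharIdeal_dvd_cyclotomicPrime_of_surjective)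
    (hX : ClassX4M W p) (hr : W.analyticRank = 0) (hsurj : Surj W p)
    {q : ℚ} (hq : shaAn W = (q : ℂ)) (hv : padicValRat p q ≤ 2) (hdvd : p ∣ W.shaOrder) :
    X4.MissingInputAt W p :=
  (ClassX4M.missingInputAt_iff_lower_rankZero_of_surj hDel hGZK hmod hmodD hL20 hKato hX hr hsurj).mpr
    (missingLowerBoundAt_of_casselsTate_of_pow_dvd W p hCT (hGZK W (by omega)).2 hq (k := 1)
      (by simpa using hv) (by simpa using hdvd))

/-! ### §2 `p = 3` (the readings of record for the 57 window rows at `3`: A122 / A123 inputs) -/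

/-- **X3♯(M) ∧ `r_an(E) = 0` at `p = 3`, `ord₃ #Ш_an(E) ≤ 2`, certificate `3 ∣ #Ш(E/ℚ)` ⇒ `BSD(E,3)`**
(window rows 8190bz1, 13860x1, 15138i1, `#Ш_an = 9`). Upper half: `ClassX3M.missingUpperBoundAt_three_rankZero`
(Delbourgo Prop. 4, GZK, modularity, Wuthrich Thm. 16 `ω`-component `hW16` = A122); lower half:
Cassels–Tate + certificate. Per curve. [cite: SilvermanAEC2009, Thm. X.4.14]
[cite: Delbourgo1998, Prop. 4 (p. 144)] [cite: Wuthrich2014, Thm. 16 (p. 397)] -/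
theorem ClassX3M.bsdp_three_rankZero_of_casselsTate_of_dvd
    (hCT : exists_casselsTate_pairing (K := ℚ))
    (hDel : Delbourgo1998.prop4_rankZero_pow_dvd_constantCoeff)
    (hGZK : rank_eq_analyticRank_of_analyticRank_le_one) (hmod : hasEntireLFunction_rat)
    (hmodD : nonempty_modularParametrizationData)
    (hW16 : Wuthrich2014.thm16_minusEigenCharIdeal_dvd_cyclotomicThree)
    (hX : ClassX3M W 3) (hr : W.analyticRank = 0)
    {q : ℚ} (hq : shaAn W = (q : ℂ)) (hv : padicValRat 3 q ≤ 2) (hdvd : 3 ∣ W.shaOrder) :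
    BSDp W 3 :=
  ClassX3M.bsdp_three_rankZero_of_lower hDel hGZK hmod hmodD hW16 hX hr
    (missingLowerBoundAt_of_casselsTate_of_pow_dvd W 3 hCT (hGZK W (by omega)).2 hq (k := 1)
      (by simpa using hv) (by simpa using hdvd))

/-- **Element-shaped certificate**: X3♯(M) ∧ `r_an(E) = 0` at `p = 3`, `ord₃ #Ш_an(E) ≤ 2`, and a
nonzero `x ∈ Ш(E/ℚ)` with `3x = 0` ⇒ `BSD(E,3)` (`dvd_shaOrder_of_exists_torsion`).
[cite: SilvermanAEC2009, Thm. X.4.14] [cite: Delbourgo1998, Prop. 4 (p. 144)] [cite: Wuthrich2014, Thm. 16 (p. 397)] -/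
theorem ClassX3M.bsdp_three_rankZero_of_casselsTate_of_exists_torsion
    (hCT : exists_casselsTate_pairing (K := ℚ))
    (hDel : Delbourgo1998.prop4_rankZero_pow_dvd_constantCoeff)
    (hGZK : rank_eq_analyticRank_of_analyticRank_le_one) (hmod : hasEntireLFunction_rat)
    (hmodD : nonempty_modularParametrizationData)
    (hW16 : Wuthrich2014.thm16_minusEigenCharIdeal_dvd_cyclotomicThree)
    (hX : ClassX3M W 3) (hr : W.analyticRank = 0)
    {q : ℚ} (hq : shaAn W = (q : ℂ)) (hv : padicValRat 3 q ≤ 2)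
    (hx : ∃ x : W.sha, x ≠ 0 ∧ 3 • x = 0) : BSDp W 3 :=
  ClassX3M.bsdp_three_rankZero_of_casselsTate_of_dvd hCT hDel hGZK hmod hmodD hW16 hX hr hq hv
    (dvd_shaOrder_of_exists_torsion W 3 hx)

/-- **X4(M) ∧ `r_an(E) = 0` ∧ surj(3) at `p = 3`, `ord₃ #Ш_an(E) ≤ 2`, certificate `3 ∣ #Ш(E/ℚ)` ⇒
`BSD(E,3)`** — the 54 ‖ 21 window rows with `#Ш_an = 9` and sha-2's two-implementation certificate
`Ш(E)[3] = (ℤ/3)²` (of which `Ш(E)[3] ≠ 0` suffices here). Upper half: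
`ClassX4M.missingUpperBoundAt_three_rankZero_of_surj` (Delbourgo Prop. 4, GZK, modularity, Wuthrich
Lemma 20 `hL20`, Kato 17.4 (3)–Cor. 19 `ω`-component `hKato` = A123); lower half: Cassels–Tate +
certificate. Per curve; NOT a class theorem. [cite: SilvermanAEC2009, Thm. X.4.14]
[cite: Delbourgo1998, Prop. 4 (p. 144)] [cite: Wuthrich2014, Lemma 20 (p. 399), Cor. 19 (p. 398)]
[cite: Kato2004Asterisque, Thm. 17.4 (3) (p. 273)] -/
theorem ClassX4M.bsdp_three_rankZero_of_surj_of_casselsTate_of_dvd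
    (hCT : exists_casselsTate_pairing (K := ℚ))
    (hDel : Delbourgo1998.prop4_rankZero_pow_dvd_constantCoeff)
    (hGZK : rank_eq_analyticRank_of_analyticRank_le_one) (hmod : hasEntireLFunction_rat)
    (hmodD : nonempty_modularParametrizationData)
    (hL20 : Wuthrich2014.lemma20_surjective_threeAdic_of_semistable)
    (hKato : Wuthrich2014.kato_minusEigenCharIdeal_dvd_cyclotomicThree_of_surjective)
    (hX : ClassX4M W 3) (hr : W.analyticRank = 0) (hsurj : Surj W 3)
    {q : ℚ} (hq : shaAn W = (q : ℂ)) (hv : padicValRat 3 q ≤ 2) (hdvd : 3 ∣ W.shaOrder) :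
    BSDp W 3 :=
  ClassX4M.bsdp_three_rankZero_of_surj_of_lower hDel hGZK hmod hmodD hL20 hKato hX hr hsurj
    (missingLowerBoundAt_of_casselsTate_of_pow_dvd W 3 hCT (hGZK W (by omega)).2 hq (k := 1)
      (by simpa using hv) (by simpa using hdvd))

/-- **Element-shaped certificate**: X4(M) ∧ `r_an(E) = 0` ∧ surj(3) at `p = 3`, `ord₃ #Ш_an(E) ≤ 2`,
and a nonzero `x ∈ Ш(E/ℚ)` with `3x = 0` ⇒ `BSD(E,3)`. [cite: SilvermanAEC2009, Thm. X.4.14]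
[cite: Delbourgo1998, Prop. 4 (p. 144)] [cite: Wuthrich2014, Lemma 20 (p. 399), Cor. 19 (p. 398)] -/
theorem ClassX4M.bsdp_three_rankZero_of_surj_of_casselsTate_of_exists_torsion
    (hCT : exists_casselsTate_pairing (K := ℚ))
    (hDel : Delbourgo1998.prop4_rankZero_pow_dvd_constantCoeff)
    (hGZK : rank_eq_analyticRank_of_analyticRank_le_one) (hmod : hasEntireLFunction_rat)
    (hmodD : nonempty_modularParametrizationData)
    (hL20 : Wuthrich2014.lemma20_surjective_threeAdic_of_semistable)
    (hKato : Wuthrich2014.kato_minusEigenCharIdeal_dvd_cyclotomicThree_of_surjective)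
    (hX : ClassX4M W 3) (hr : W.analyticRank = 0) (hsurj : Surj W 3)
    {q : ℚ} (hq : shaAn W = (q : ℂ)) (hv : padicValRat 3 q ≤ 2)
    (hx : ∃ x : W.sha, x ≠ 0 ∧ 3 • x = 0) : BSDp W 3 :=
  ClassX4M.bsdp_three_rankZero_of_surj_of_casselsTate_of_dvd hCT hDel hGZK hmod hmodD hL20 hKato hX
    hr hsurj hq hv (dvd_shaOrder_of_exists_torsion W 3 hx)

/-- **X4(M) ∧ `r_an(E) = 0` ∧ `3 ∤ ord₃ j(E)` at `p = 3`, `ord₃ #Ш_an(E) ≤ 2`, certificate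
`3 ∣ #Ш(E/ℚ)` ⇒ `BSD(E,3)`** — surj(3) decided in the kernel by `3 ∤ ord₃ j(E)` (e.g. 13221g1,
`ord₃ j = −19`, `3 ∣ ∏c_ℓ = 24`, `#Ш_an = 9`: structurally outside the Heegner-index route, closed by
this reading given the certificate). [cite: SilvermanATAEC1994, V.6 Prop. 6.1 (p. 410) and V.5.3]
[cite: SilvermanAEC2009, Thm. X.4.14] [cite: Wuthrich2014, Lemma 20 (p. 399), Cor. 19 (p. 398)] -/
theorem ClassX4M.bsdp_three_rankZero_of_not_dvd_padicValRat_j_of_casselsTate_of_dvd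
    (hCT : exists_casselsTate_pairing (K := ℚ))
    (hDel : Delbourgo1998.prop4_rankZero_pow_dvd_constantCoeff)
    (hGZK : rank_eq_analyticRank_of_analyticRank_le_one) (hmod : hasEntireLFunction_rat)
    (hmodD : nonempty_modularParametrizationData)
    (hL20 : Wuthrich2014.lemma20_surjective_threeAdic_of_semistable)
    (hKato : Wuthrich2014.kato_minusEigenCharIdeal_dvd_cyclotomicThree_of_surjective)
    (hX : ClassX4M W 3) (hr : W.analyticRank = 0) (hj : ¬ (3 : ℤ) ∣ padicValRat 3 W.j)
    {q : ℚ} (hq : shaAn W = (q : ℂ)) (hv : padicValRat 3 q ≤ 2) (hdvd : 3 ∣ W.shaOrder) :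
    BSDp W 3 :=
  ClassX4M.bsdp_three_rankZero_of_not_dvd_padicValRat_j_of_lower hDel hGZK hmod hmodD hL20 hKato hX hr
    hj (missingLowerBoundAt_of_casselsTate_of_pow_dvd W 3 hCT (hGZK W (by omega)).2 hq (k := 1)
      (by simpa using hv) (by simpa using hdvd))

end Summit.BirchSwinnertonDyer.Rank1Residual.AdditivePotMult

end
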